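import Mathlib

/-!
# Constant-sum words: the pigeonhole counting step (support file)

Item `stmt-MatrixMultiplication-14308` (`FourierTwoFamiliesModP.PrimeTwoFamilies`), line Sketch.
The lifted SDPP family is indexed by the words `w : Fin L → Fin r` of ONE fixed digit sum `S`.
Among the `r ^ L` words the digit sums `∑ t, (w t : ℕ)` lie in `{0, …, L * r}`, so by the
pigeonhole principle some digit sum `S` is attained by at least `r ^ L / (L * r + 1)` words:
`r ^ L ≤ (L * r + 1) * #{w | ∑ t, (w t : ℕ) = S}` (`stub_words`).
-/

-- single-conjunct summit: the mandated namespace `Summit.MatrixMultiplication.MatrixMultiplication.…`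
-- repeats `MatrixMultiplication` (summit = sub-problem), which `linter.dupNamespace` would flag.
set_option linter.dupNamespace false

namespace Summit.MatrixMultiplication.MatrixMultiplication.Theorems.PrimeTwoFamilies.LadderLift

open Finset

/-- Pigeonhole on the values of `f : α → ℕ` bounded by `N` on `s`: the largest fiber of `f` over
`{0, …, N}` has at least `#s / (N + 1)` elements. -/
private theorem exists_card_le_mul_card_fiber {α : Type*} (s : Finset α) (f : α → ℕ) (N : ℕ)
    (hf : ∀ a ∈ s, f a ≤ N) : ∃ S : ℕ, #s ≤ (N + 1) * #(s.filter (fun a => f a = S)) := by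
  obtain ⟨S, -, hS⟩ := Finset.exists_max_image (Finset.range (N + 1))
    (fun b => #(s.filter (fun a => f a = b))) ⟨0, by simp⟩
  refine ⟨S, ?_⟩
  calc #s ≤ #(s.filter (fun a => f a = S)) * #(Finset.range (N + 1)) :=
        Finset.card_le_mul_card_image_of_maps_to
          (fun a ha => Finset.mem_range.2 (Nat.lt_add_one_iff.2 (hf a ha))) _ hS
    _ = (N + 1) * #(s.filter (fun a => f a = S)) := by rw [Finset.card_range, mul_comm]

/-- The digit sum of a word `w : Fin L → Fin r` is at most `L * r`. -/
private theorem digitSum_le (r L : ℕ) (w : Fin L → Fin r) : ∑ t, ((w t : ℕ)) ≤ L * r :=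
  calc ∑ t, ((w t : ℕ)) ≤ ∑ _t : Fin L, r := Finset.sum_le_sum fun t _ => (w t).isLt.le
    _ = L * r := by simp

/-- **Counting step (pigeonhole on digit sums).** Some digit sum `S` is attained by at least a
`1 / (L * r + 1)` fraction of the `r ^ L` words `w : Fin L → Fin r`:
`r ^ L ≤ (L * r + 1) * #{w | ∑ t, (w t : ℕ) = S}`. -/
theorem stub_words (r L : ℕ) :
    ∃ S : ℕ, r ^ L ≤ (L * r + 1) *
      (Finset.univ.filter (fun w : Fin L → Fin r => ∑ t, ((w t : ℕ)) = S)).card := by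
  obtain ⟨S, hS⟩ := exists_card_le_mul_card_fiber (Finset.univ : Finset (Fin L → Fin r))
    (fun w => ∑ t, ((w t : ℕ))) (L * r) (fun w _ => digitSum_le r L w)
  refine ⟨S, ?_⟩
  calc r ^ L = #(Finset.univ : Finset (Fin L → Fin r)) := by simp
    _ ≤ (L * r + 1) * #(Finset.univ.filter (fun w : Fin L → Fin r => ∑ t, ((w t : ℕ)) = S)) := hS

end Summit.MatrixMultiplication.MatrixMultiplication.Theorems.PrimeTwoFamilies.LadderLift
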